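import Summits.PneNP.PneNP.Theses.ORIncompressibility

/-!
# Refutation of `ORIncompressibility.NoTC0CompressionSAT` (stmt-PneNP-0988)

Every member of `SAT = encodingCNF.toLanguage {φ | φ.Satisfiable}` has EVEN length: the list
encoding `listBool` wraps its payload in `boolPair`, whose length is `2|x| + 2 + |y|`, and the
payload is an iterated `boolPair … []`, again of even length. Hence at every ODD block length `n`
no block `List.ofFn (…) : List Bool` of length `n` lies in `SAT`, the predicate
`∃ i, block_i ∈ SAT` is constantly `False` on both sides, and the conclusion
`∃ x y, … ∧ ¬ ((∃ i, …) ↔ (∃ i, …))` demanded by `NoTC0CompressionSAT` for ALL `n ≥ n₀`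
(take `d = k = 0`, `c = 1`, `c' = 0`, `m = 0`, the empty circuit family) fails.
Witness: `n = 2 n₀ + 1`, `m = 0`. [folklore]
-/

open Literature.Computability.Complexity

namespace Summit.PneNP.PneNP.Theorems

/-- **Record of the dropped route item `NoTC0CompressionSAT`** = stmt-PneNP-0988 (ledger
signature verbatim; NOT a route item): the route no longer declares this constant (repair by `restate`/`drop`), while
the theorem below — which closed the item at b199f26fbc0d and is indexed under this name —
still refers to it. Re-declared here under its original fully-qualified name and definiens solely
so that this record keeps elaborating (Theorems files are append-only: the theorem's statement
text may not change). It is FALSE as stated (SAT codewords have even length; see below); dropped by the route. -/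
def _root_.Summit.PneNP.PneNP.Theses.ORIncompressibility.NoTC0CompressionSAT : Prop :=
    ∀ d k c c' : ℕ, c' < c → ∃ n₀ : ℕ, ∀ n ≥ n₀, ∀ m ≤ n ^ c', ∀ C : Fin m →
    Literature.Computability.Complexity.Circuit (Fin (n ^ c * n)), (∀ j, (C j).IsOver
    Literature.Computability.Complexity.tcBasis ∧ (C j).acDepth ≤ d ∧ (C j).size ≤ (n ^ c * n) ^ k)
    → ∃ x y : Fin (n ^ c * n) → Bool, (∀ j, (C j).eval x = (C j).eval y) ∧ ¬ ((∃ i : Fin (n ^ c),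
    List.ofFn (fun l : Fin n => x (finProdFinEquiv (i, l))) ∈
    Literature.Computability.Complexity.SAT) ↔ ∃ i : Fin (n ^ c), List.ofFn (fun l : Fin n => y
    (finProdFinEquiv (i, l))) ∈ Literature.Computability.Complexity.SAT)

/-- Refutes `ORIncompressibility.NoTC0CompressionSAT`: the statement demands, for ALL large block
lengths `n`, two inputs whose tuples differ on `[∃ i, block_i ∈ SAT]`; but `SAT` contains only
even-length strings (codewords of `encodingCNF = encodingClause.listBool`, i.e.
`boolPair (unary length) (foldr boolPair [])`, of length `2·_ + 2 + even`), so at odd `n` that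
predicate is constantly false and no such pair exists; witness `d = k = 0, c = 1, c' = 0,
n = 2 n₀ + 1, m = 0` (empty `TC⁰` family). [folklore] -/
theorem ORIncompressibilityNoTC0CompressionSAT_refuted :
    ¬ Summit.PneNP.PneNP.Theses.ORIncompressibility.NoTC0CompressionSAT := by
  -- (1) the iterated pairing of encoded clauses has even length
  have hfold : ∀ φ : CNF ℕ,
      Even (φ.foldr (fun a acc => boolPair (encodingClause.encode a) acc) []).length := by
    intro φ
    induction φ with
    | nil => simp
    | cons a l ih =>
        simp only [List.foldr_cons, length_boolPair]
        obtain ⟨k, hk⟩ := ih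
        exact ⟨(encodingClause.encode a).length + 1 + k, by omega⟩
  -- (2) every string of `SAT` has even length
  have heven : ∀ w ∈ SAT, Even w.length := by
    intro w hw
    unfold SAT Computability.Encoding.toLanguage at hw
    obtain ⟨φ, -, rfl⟩ := hw
    have h1 : encodingCNF.encode φ = boolPair (Computability.unaryEncodeNat φ.length)
        (φ.foldr (fun a acc => boolPair (encodingClause.encode a) acc) []) := rfl
    rw [h1, length_boolPair]
    obtain ⟨k, hk⟩ := hfold φ
    exact ⟨(Computability.unaryEncodeNat φ.length).length + 1 + k, by omega⟩
  -- (3) instantiate the statement at an odd block length with the empty circuit family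
  intro h
  unfold Summit.PneNP.PneNP.Theses.ORIncompressibility.NoTC0CompressionSAT at h
  obtain ⟨n₀, hn₀⟩ := h 0 0 1 0 Nat.zero_lt_one
  have key : ∀ f : Fin (2 * n₀ + 1) → Bool, List.ofFn f ∉ SAT := fun f hf =>
    (Nat.not_even_iff_odd.mpr (by rw [List.length_ofFn]; exact odd_two_mul_add_one n₀)) (heven _ hf)
  obtain ⟨x, y, -, hne⟩ :=
    hn₀ (2 * n₀ + 1) (by omega) 0 (Nat.zero_le _) (fun j => j.elim0) (fun j => j.elim0)
  exact hne ⟨fun ⟨i, hi⟩ => (key _ hi).elim, fun ⟨i, hi⟩ => (key _ hi).elim⟩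

end Summit.PneNP.PneNP.Theorems
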